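import Literature.NumberTheory.EllipticCurves.Rank1Residual.GVParityTransferProofs
import Literature.NumberTheory.EllipticCurves.Isogeny
import Literature.NumberTheory.NumberFields.CongruenceSubgroupTorsionFree
import HarnessLib

/-!
# The Greenberg–Vatsal parity type is an isogeny invariant: transfer of `GVPar` along an isogeny,
# given Serre's ordinary line and the signs of complex conjugation

HONEST FRAMING (cell `b2b-bsdres`, home `run/shared/lean/b2b/bsd-rank1-residual/`): the cell deletes
COMBINATION-SHAPED residual classes of the rank-`≤ 1` BSD formula from PUBLISHED theorems only and
types the rest; this is not "finishing BSD". `Proofs`-style file (theorems only, no definition, no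
named fact), sequel of `Rank1Residual/GVParityTwistProofs.lean` (prover x1a gen 1: the twist law);
prover x1a gen 2. It settles, in conditional form, the debt "GVPar isogeny-invariance not
formalised" (cell REFEREE R9.6), which the census of class X1 uses (the parity type A/B of
`b2b-bsdres-x1a/X1-CENSUS-g2.md` is computed per Cremona isogeny class and was checked to be the same
on every curve of all 1524 classes).

Recall (`Rank1Residual/Predicates.lean`): `GVPar W p` — SOME rational `p`-isogeny kernel `Φ ≤ E[p]`
is (ramified at `p` ∧ even) ∨ (unramified at `p` ∧ odd) [Greenberg–Vatsal 2000, Thm. 1.3]. The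
mathematics: with `E[p]^ss = φ ⊕ ψ`, `φψ = ω`, at a good ordinary odd `p` exactly one of `φ, ψ` is
unramified at `p` (the kernel of reduction is the unique ramified line and inertia is trivial on
the quotient — Serre 1972, §1.11 Prop. 11 and Cor.) and exactly one is even (`det ρ̄(c) = -1`);
so "`Φ` qualifies" says "the unramified constituent of `E[p]^ss` is odd", a property of the
semisimplification, hence of the isogeny class. The two local/archimedean inputs enter here as
HYPOTHESES on the curve (to be discharged later from the tree's local theory —
`exists_line_geomTorsion_of_not_dvd_frobeniusTraceAt` of `OrdinaryReductionTorsionLineProofs` is the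
`absInertia` form of (hL); (hc) is `E(ℝ)[p] ≅ ℤ/p` for odd `p`):
* (hL) for every prime `𝔓` of `\bar ℤ` above `p`: a subgroup `L ≤ E[p]` of order `p` with
  `σ • P - P ∈ L` for all `σ ∈ I_𝔓`, `P ∈ E[p]`, and some `σ ∈ I_𝔓` moving a point of `L`;
* (hc) every complex conjugation of `Γ_ℚ` has a non-zero fixed and a non-zero anti-fixed point
  on `E[p]`.

Proved here (all [folklore]; Silverman AEC III.4, III.6.4; Serre 1972 §1.11; GV 2000 §1), on top
of `GVParityTransferProofs.lean` (lines of `E[p]`, transport along a map injective on the line,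
ramification at every prime above `p`):
* `isRationalLine_range`, `smul_mem_ker`, `gvPar_of_ker_line` — the kernel-line case: if `ker g`
  has order `p` and is of Greenberg–Vatsal type, so is `g(E[p]) ≅ E[p]/ker g` (this is where
  (hL), (hc) are used: "`K` ramified ⟺ quotient unramified", "`K` even ⟺ quotient odd").
* `gvPar_of_isogeny` — **for a `ℚ`-isogeny `f : E → E'` with `E[p] ⊄ ker f` (e.g. cyclic), `p`
  odd, (hL) and (hc) for `E`: `GVPar W p → GVPar W' p`**; `gvPar_iff_of_isogeny` — the iff for a
  pair of such isogenies `E ⇄ E'` with the hypotheses for both curves.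

## References
* R. Greenberg, V. Vatsal, Invent. Math. 142 (2000), Thm. (1.3) and §1. [GreenbergVatsal2000]
* J.-P. Serre, Invent. Math. 15 (1972), §1.11, Prop. 11 and Cor. [SerreInventiones1972]
* J. H. Silverman, *AEC*, III.4, III.6.4, III.7. [SilvermanAEC2009]
-/


set_option autoImplicit false

noncomputable section

open scoped Classical

open WeierstrassCurve Literature.NumberTheory.EllipticCurves Literature.NumberTheory.GaloisRepresentations
  Field IsDedekindDomain NumberField

namespace Literature.NumberTheory.EllipticCurves.Rank1Residual

variable {W W' : WeierstrassCurve ℚ} [W.IsElliptic] [W'.IsElliptic] {p : ℕ} [Fact p.Prime]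

/-! ### The kernel-line case: transfer through the quotient `E[p]/K ≅ g(E[p])` -/

section KernelLine

variable (g : geomTorsion W (p : ℤ) →+ geomTorsion W' (p : ℤ))
  (hg : ∀ (σ : absoluteGaloisGroup ℚ) (P : geomTorsion W (p : ℤ)), g (σ • P) = σ • g P)

omit [W.IsElliptic] [W'.IsElliptic] in
include hg in
/-- The image of a `Γ_ℚ`-equivariant `g : E[p] → E'[p]` whose kernel has order `p` is a rational
line of `E'[p]` (`#E[p] = p²`). [folklore] -/
theorem isRationalLine_range (hE : Nat.card (geomTorsion W (p : ℤ)) = p ^ 2)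
    (hK : Nat.card g.ker = p) : IsRationalLine W' p g.range := by
  have hp : p.Prime := Fact.out
  refine ⟨?_, ?_⟩
  · have h1 : Nat.card g.ker * g.ker.index = Nat.card (geomTorsion W (p : ℤ)) :=
      g.ker.card_mul_index
    rw [hE, hK, AddSubgroup.index_ker, pow_two] at h1
    have h2 : Nat.card (Set.range g) = p := Nat.eq_of_mul_eq_mul_left hp.pos h1
    change Nat.card ((g.range : Set (geomTorsion W' (p : ℤ)))) = p
    rw [AddMonoidHom.coe_range]
    exact h2
  · intro σ Q hQ
    obtain ⟨P, rfl⟩ := AddMonoidHom.mem_range.mp hQ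
    exact AddMonoidHom.mem_range.mpr ⟨σ • P, hg σ P⟩

omit [W.IsElliptic] [W'.IsElliptic] [Fact p.Prime] in
include hg in
/-- The kernel of a `Γ_ℚ`-equivariant `g : E[p] → E'[p]` is `Γ_ℚ`-stable. [folklore] -/
theorem smul_mem_ker {σ : absoluteGaloisGroup ℚ} {P : geomTorsion W (p : ℤ)} (hP : P ∈ g.ker) :
    σ • P ∈ g.ker := by
  rw [AddMonoidHom.mem_ker] at hP ⊢
  rw [hg, hP, smul_zero]

omit [W.IsElliptic] [W'.IsElliptic] in
include hg in
/-- **The kernel-line transfer.** Let `g : E[p] → E'[p]` be `Γ_ℚ`-equivariant with kernel `K` of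
order `p` (so `g(E[p]) ≅ E[p]/K` is a rational line of `E'[p]`), `p` odd, `#E[p] = p²`. Assume
(hL) Serre's ordinary line at every prime `𝔓` above `p`: a subgroup `L ≤ E[p]` of order `p` with
`(σ - 1)E[p] ⊆ L` for all `σ ∈ I_𝔓` and some `σ ∈ I_𝔓` moving a point of `L` (Serre 1972 §1.11
Prop. 11 and Cor. at a good ordinary prime); (hc) every complex conjugation has a non-zero fixed
and a non-zero anti-fixed `p`-torsion point (`det ρ̄(c) = -1`). If `K` is (ramified ∧ even) or
(unramified ∧ odd), then so is `g(E[p])`, the two dichotomies "`K` ramified ⟺ `E[p]/K` unramified"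
and "`K` even ⟺ `E[p]/K` odd" being exactly what (hL), (hc) give; hence `GVPar W' p`. [folklore] -/
theorem gvPar_of_ker_line (hp2 : p ≠ 2) (hE : Nat.card (geomTorsion W (p : ℤ)) = p ^ 2)
    (hL : ∀ (v : HeightOneSpectrum (𝓞 ℚ)), (p : 𝓞 ℚ) ∈ v.asIdeal → ∀ 𝔓 ∈ v.primesAbove,
      ∃ L : AddSubgroup (geomTorsion W (p : ℤ)), Nat.card L = p ∧
        (∀ σ ∈ 𝔓.inertia (absoluteGaloisGroup ℚ), ∀ P : geomTorsion W (p : ℤ), σ • P - P ∈ L) ∧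
        (∃ σ ∈ 𝔓.inertia (absoluteGaloisGroup ℚ), ∃ P ∈ L, σ • P ≠ P))
    (hc : ∀ c : absoluteGaloisGroup ℚ, IsComplexConjugation (Rat.castHom ℝ) c →
      (∃ P : geomTorsion W (p : ℤ), P ≠ 0 ∧ c • P = P) ∧
        (∃ Q : geomTorsion W (p : ℤ), Q ≠ 0 ∧ c • Q = -Q))
    (hK : Nat.card g.ker = p)
    (hQ : (¬ LineUnramifiedAt W p g.ker ∧ LineEven W p g.ker) ∨
      (LineUnramifiedAt W p g.ker ∧ LineOdd W p g.ker)) :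
    GVPar W' p := by
  have hp : p.Prime := Fact.out
  have hKline : IsRationalLine W p g.ker := ⟨hK, fun σ P hP ↦ smul_mem_ker g hg hP⟩
  have hΨ : IsRationalLine W' p g.range := isRationalLine_range g hg hE hK
  -- complex conjugation acts on the line `g(E[p])` by `+1` or by `-1`
  have hsign : ∀ c : absoluteGaloisGroup ℚ, IsComplexConjugation (Rat.castHom ℝ) c →
      (∀ y ∈ g.range, c • y = y) ∨ (∀ y ∈ g.range, c • y = -y) :=
    fun c hcc ↦ smul_eq_self_or_eq_neg_of_sq_eq_one hΨ hcc.sq_eq_one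
  -- `c • c • P = P`
  have hcc2 : ∀ c : absoluteGaloisGroup ℚ, IsComplexConjugation (Rat.castHom ℝ) c →
      ∀ P : geomTorsion W (p : ℤ), c • c • P = P := by
    intro c hcc P
    rw [← mul_smul, ← pow_two, hcc.sq_eq_one, one_smul]
  refine ⟨g.range, hΨ, ?_⟩
  rcases hQ with ⟨hr, he⟩ | ⟨hu, ho⟩
  · -- `K` ramified and even ⇒ `g(E[p])` unramified and odd
    refine Or.inr ⟨?_, ?_⟩
    · intro v hv 𝔓 h𝔓 σ hσ y hy
      obtain ⟨P, rfl⟩ := AddMonoidHom.mem_range.mp hy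
      obtain ⟨L, hLcard, hLsub, -⟩ := hL v hv 𝔓 h𝔓
      -- `K = L`: `K` is moved by `I_𝔓` (ramified everywhere above `p`), so `K ⊓ L ≠ ⊥`
      have hKL : g.ker = L := by
        rcases line_eq_or_inf_eq_bot hK hLcard with h | h
        · exact h
        · exfalso
          obtain ⟨τ, hτ, P₀, hP₀, hne⟩ :=
            exists_inertia_smul_ne_of_not_lineUnramifiedAt hKline hr v hv 𝔓 h𝔓
          have hmem : τ • P₀ - P₀ ∈ g.ker ⊓ L :=
            AddSubgroup.mem_inf.mpr ⟨g.ker.sub_mem (smul_mem_ker g hg hP₀) hP₀, hLsub τ hτ P₀⟩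
          rw [h, AddSubgroup.mem_bot, sub_eq_zero] at hmem
          exact hne hmem
      have h1 : σ • P - P ∈ g.ker := hKL ▸ hLsub σ hσ P
      rw [AddMonoidHom.mem_ker, map_sub, hg, sub_eq_zero] at h1
      exact h1
    · intro c hcc y hy
      rcases hsign c hcc with hplus | hminus
      · -- `c = +1` on `g(E[p])` and on `K` forces `c = 1` on `E[p]`: contradiction
        exfalso
        obtain ⟨-, Q, hQ0, hQ⟩ := hc c hcc
        have hall : ∀ P : geomTorsion W (p : ℤ), c • P = P := by
          intro P
          have h1 : c • g P = g P := hplus (g P) (AddMonoidHom.mem_range.mpr ⟨P, rfl⟩)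
          have h2 : c • P - P ∈ g.ker := by
            rw [AddMonoidHom.mem_ker, map_sub, hg, h1, sub_self]
          have h3 : c • (c • P - P) = c • P - P := he c hcc _ h2
          rw [smul_sub, hcc2 c hcc P] at h3
          -- `P - c P = c P - P` ⇒ `2 (c P - P) = 0`
          have h4 : (c • P - P) + (c • P - P) = 0 := by
            have hx : c • P - P = -(c • P - P) := by rw [neg_sub]; exact h3.symm
            nth_rewrite 2 [hx]
            exact add_neg_cancel _
          exact sub_eq_zero.mp (eq_zero_of_add_self_eq_zero hp2 h4)
        have : Q + Q = 0 := by
          have hq := hall Q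
          rw [hQ] at hq
          -- `hq : -Q = Q`
          nth_rewrite 1 [← hq]
          exact neg_add_cancel Q
        exact hQ0 (eq_zero_of_add_self_eq_zero hp2 this)
      · exact hminus y hy
  · -- `K` unramified and odd ⇒ `g(E[p])` ramified and even
    refine Or.inl ⟨?_, ?_⟩
    · intro hunr
      obtain ⟨v, hv⟩ :=
        Literature.NumberTheory.NumberFields.RingOfIntegers.exists_heightOneSpectrum_natCast_mem ℚ hp
      obtain ⟨𝔓, h𝔓⟩ := HeightOneSpectrum.primesAbove_nonempty v
      obtain ⟨L, hLcard, hLsub, σ₀, hσ₀, x₀, hx₀, hne⟩ := hL v hv 𝔓 h𝔓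
      -- `K ≠ L` since `K` is unramified and `L` has a moved point; hence `K ⊓ L = ⊥`
      have hKL : g.ker ⊓ L = ⊥ := by
        rcases line_eq_or_inf_eq_bot hK hLcard with h | h
        · exfalso
          exact hne (hu v hv 𝔓 h𝔓 σ₀ hσ₀ x₀ (h ▸ hx₀))
        · exact h
      -- `y = g x₀` is moved by `σ₀`
      have hy : g x₀ ∈ g.range := AddMonoidHom.mem_range.mpr ⟨x₀, rfl⟩
      have h1 : σ₀ • g x₀ = g x₀ := hunr v hv 𝔓 h𝔓 σ₀ hσ₀ _ hy
      have h2 : σ₀ • x₀ - x₀ ∈ g.ker := by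
        rw [AddMonoidHom.mem_ker, map_sub, hg, h1, sub_self]
      have h3 : σ₀ • x₀ - x₀ ∈ g.ker ⊓ L := AddSubgroup.mem_inf.mpr ⟨h2, hLsub σ₀ hσ₀ x₀⟩
      rw [hKL, AddSubgroup.mem_bot, sub_eq_zero] at h3
      exact hne h3
    · intro c hcc y hy
      rcases hsign c hcc with hplus | hminus
      · exact hplus y hy
      · -- `c = -1` on `g(E[p])` and on `K` forces `c = -1` on `E[p]`: contradiction
        exfalso
        obtain ⟨⟨P₀, hP₀0, hP₀⟩, -⟩ := hc c hcc
        have hall : ∀ P : geomTorsion W (p : ℤ), c • P = -P := by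
          intro P
          have h1 : c • g P = -g P := hminus (g P) (AddMonoidHom.mem_range.mpr ⟨P, rfl⟩)
          have h2 : c • P + P ∈ g.ker := by
            rw [AddMonoidHom.mem_ker, map_add, hg, h1, neg_add_cancel]
          have h3 : c • (c • P + P) = -(c • P + P) := ho c hcc _ h2
          rw [smul_add, hcc2 c hcc P] at h3
          -- `P + c P = -(c P + P)` ⇒ `2 (c P + P) = 0`
          have h4 : (c • P + P) + (c • P + P) = 0 := by
            have hx : c • P + P = -(c • P + P) :=
              calc c • P + P = P + c • P := add_comm _ _
                _ = -(c • P + P) := h3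
            nth_rewrite 2 [hx]
            exact add_neg_cancel _
          have h5 : c • P + P = 0 := eq_zero_of_add_self_eq_zero hp2 h4
          exact eq_neg_of_add_eq_zero_left h5
        have : P₀ + P₀ = 0 := by
          have hq := hall P₀
          rw [hP₀] at hq
          -- `hq : P₀ = -P₀`
          nth_rewrite 2 [hq]
          exact add_neg_cancel P₀
        exact hP₀0 (eq_zero_of_add_self_eq_zero hp2 this)

end KernelLine

/-! ### Transfer of `GVPar` along an isogeny -/

section Main

omit [W'.IsElliptic] in
/-- **The Greenberg–Vatsal parity type passes along an isogeny not killing `E[p]`** (given, for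
the SOURCE curve, Serre's ordinary line at every prime above `p` (hL) and the two signs of complex
conjugation on `E[p]` (hc)). Let `f : E → E'` be a `ℚ`-isogeny with `E[p] ⊄ ker f`, `p` odd. If
`E` has a rational `p`-isogeny kernel of Greenberg–Vatsal type ((ramified ∧ even) ∨ (unramified ∧
odd)), so has `E'`. Proof: restrict `f` to `g : E[p] → E'[p]`; if `g` is injective on the line
`Φ`, transport (`gvPar_of_map_injOn`); otherwise `Φ = ker g` has order `p` and the image
`g(E[p]) ≅ E[p]/Φ` is a line of the same type (`gvPar_of_ker_line`); `ker g = E[p]` is excluded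
by `hf`. Hypotheses (hL), (hc) hold at every good ordinary odd `p` (Serre 1972 §1.11 Prop. 11 and
Cor.; `E(ℝ)[p] ≅ ℤ/p` and `det ρ̄_{E,p}(c) = -1`) and are left to be discharged from the tree's
local theory (`exists_line_geomTorsion_of_not_dvd_frobeniusTraceAt` is the `absInertia` form of
(hL)). [folklore] -/
theorem gvPar_of_isogeny (hp2 : p ≠ 2)
    (hL : ∀ (v : HeightOneSpectrum (𝓞 ℚ)), (p : 𝓞 ℚ) ∈ v.asIdeal → ∀ 𝔓 ∈ v.primesAbove,
      ∃ L : AddSubgroup (geomTorsion W (p : ℤ)), Nat.card L = p ∧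
        (∀ σ ∈ 𝔓.inertia (absoluteGaloisGroup ℚ), ∀ P : geomTorsion W (p : ℤ), σ • P - P ∈ L) ∧
        (∃ σ ∈ 𝔓.inertia (absoluteGaloisGroup ℚ), ∃ P ∈ L, σ • P ≠ P))
    (hc : ∀ c : absoluteGaloisGroup ℚ, IsComplexConjugation (Rat.castHom ℝ) c →
      (∃ P : geomTorsion W (p : ℤ), P ≠ 0 ∧ c • P = P) ∧
        (∃ Q : geomTorsion W (p : ℤ), Q ≠ 0 ∧ c • Q = -Q))
    (f : Isogeny W W') (hf : ∃ P : geomPoints W, P ∈ geomTorsion W (p : ℤ) ∧ f P ≠ 0)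
    (h : GVPar W p) : GVPar W' p := by
  have hp : p.Prime := Fact.out
  -- the restriction `g : E[p] →+ E'[p]` of `f`
  have hmem : ∀ P : geomTorsion W (p : ℤ), f (P : geomPoints W) ∈ geomTorsion W' (p : ℤ) := by
    intro P
    have h0 : (p : ℤ) • (P : geomPoints W) = 0 := (Submodule.mem_torsionBy_iff (p : ℤ) _).mp P.2
    have h1 : (p : ℤ) • f (P : geomPoints W) = 0 := by rw [← map_zsmul, h0, map_zero]
    exact (Submodule.mem_torsionBy_iff (p : ℤ) _).mpr h1
  let g : geomTorsion W (p : ℤ) →+ geomTorsion W' (p : ℤ) :=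
    { toFun := fun P ↦ ⟨f (P : geomPoints W), hmem P⟩
      map_zero' := Subtype.ext (by simp)
      map_add' := fun P Q ↦ Subtype.ext (by simp) }
  have hgval : ∀ P : geomTorsion W (p : ℤ), (g P : geomPoints W') = f (P : geomPoints W) :=
    fun _ ↦ rfl
  have hg : ∀ (σ : absoluteGaloisGroup ℚ) (P : geomTorsion W (p : ℤ)), g (σ • P) = σ • g P := by
    intro σ P
    apply Subtype.ext
    rw [hgval, AddSubgroup.torsionBy.coe_smul, AddSubgroup.torsionBy.coe_smul, hgval, f.map_smul]
  have hE : Nat.card (geomTorsion W (p : ℤ)) = p ^ 2 := natCard_geomTorsion W p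
  haveI : Finite (geomTorsion W (p : ℤ)) :=
    Nat.finite_of_card_ne_zero (by rw [hE]; exact pow_ne_zero 2 hp.ne_zero)
  obtain ⟨Φ, hΦ, hQ⟩ := h
  by_cases hinj : ∀ P ∈ Φ, g P = 0 → P = 0
  · exact gvPar_of_map_injOn g hg hΦ hinj hQ
  · push Not at hinj
    obtain ⟨P₁, hP₁Φ, hP₁g, hP₁0⟩ := hinj
    have hP₁K : P₁ ∈ g.ker := (AddMonoidHom.mem_ker).mpr hP₁g
    -- `#ker g ∈ {1, p, p²}`
    have hdvd : Nat.card g.ker ∣ p ^ 2 := hE ▸ g.ker.card_addSubgroup_dvd_card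
    obtain ⟨i, hi, hKi⟩ := (Nat.dvd_prime_pow hp).mp hdvd
    interval_cases i
    · -- `ker g = ⊥`: contradicts `P₁ ≠ 0`
      exfalso
      have hbot : g.ker = ⊥ := AddSubgroup.card_eq_one.mp (by simpa using hKi)
      rw [hbot, AddSubgroup.mem_bot] at hP₁K
      exact hP₁0 hP₁K
    · -- `ker g` is a line meeting `Φ` non-trivially: `Φ = ker g`
      have hK : Nat.card g.ker = p := by simpa using hKi
      have hΦK : Φ = g.ker := by
        rcases line_eq_or_inf_eq_bot hΦ.1 hK with h | h
        · exact h
        · exfalso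
          have hmem1 : P₁ ∈ Φ ⊓ g.ker := AddSubgroup.mem_inf.mpr ⟨hP₁Φ, hP₁K⟩
          rw [h, AddSubgroup.mem_bot] at hmem1
          exact hP₁0 hmem1
      rw [hΦK] at hQ
      exact gvPar_of_ker_line g hg hp2 hE hL hc hK hQ
    · -- `ker g = E[p]`: contradicts `hf`
      exfalso
      have htop : g.ker = ⊤ := AddSubgroup.eq_top_of_card_eq _ (by rw [hKi, hE])
      obtain ⟨P, hP, hfP⟩ := hf
      have hmem1 : (⟨P, hP⟩ : geomTorsion W (p : ℤ)) ∈ g.ker := by rw [htop]; exact AddSubgroup.mem_top _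
      rw [AddMonoidHom.mem_ker] at hmem1
      exact hfP (by simpa [hgval] using congrArg Subtype.val hmem1)

/-- **Isogeny invariance of the Greenberg–Vatsal parity type (conditional form).** For `ℚ`-isogenies
`f : E → E'`, `f' : E' → E` not killing the `p`-torsion (e.g. any cyclic isogeny and its dual),
`p` odd, and the hypotheses (hL) (Serre's ordinary line above `p`) and (hc) (signs of complex
conjugation) for both curves: `GVPar W p ↔ GVPar W' p`. In particular on the class X1 the type
A / B of the census (`b2b-bsdres-x1a/X1-CENSUS-g2.md`) is a property of the isogeny class.
[folklore] -/
theorem gvPar_iff_of_isogeny (hp2 : p ≠ 2)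
    (hL : ∀ (v : HeightOneSpectrum (𝓞 ℚ)), (p : 𝓞 ℚ) ∈ v.asIdeal → ∀ 𝔓 ∈ v.primesAbove,
      ∃ L : AddSubgroup (geomTorsion W (p : ℤ)), Nat.card L = p ∧
        (∀ σ ∈ 𝔓.inertia (absoluteGaloisGroup ℚ), ∀ P : geomTorsion W (p : ℤ), σ • P - P ∈ L) ∧
        (∃ σ ∈ 𝔓.inertia (absoluteGaloisGroup ℚ), ∃ P ∈ L, σ • P ≠ P))
    (hc : ∀ c : absoluteGaloisGroup ℚ, IsComplexConjugation (Rat.castHom ℝ) c →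
      (∃ P : geomTorsion W (p : ℤ), P ≠ 0 ∧ c • P = P) ∧
        (∃ Q : geomTorsion W (p : ℤ), Q ≠ 0 ∧ c • Q = -Q))
    (hL' : ∀ (v : HeightOneSpectrum (𝓞 ℚ)), (p : 𝓞 ℚ) ∈ v.asIdeal → ∀ 𝔓 ∈ v.primesAbove,
      ∃ L : AddSubgroup (geomTorsion W' (p : ℤ)), Nat.card L = p ∧
        (∀ σ ∈ 𝔓.inertia (absoluteGaloisGroup ℚ), ∀ P : geomTorsion W' (p : ℤ), σ • P - P ∈ L) ∧
        (∃ σ ∈ 𝔓.inertia (absoluteGaloisGroup ℚ), ∃ P ∈ L, σ • P ≠ P))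
    (hc' : ∀ c : absoluteGaloisGroup ℚ, IsComplexConjugation (Rat.castHom ℝ) c →
      (∃ P : geomTorsion W' (p : ℤ), P ≠ 0 ∧ c • P = P) ∧
        (∃ Q : geomTorsion W' (p : ℤ), Q ≠ 0 ∧ c • Q = -Q))
    (f : Isogeny W W') (hf : ∃ P : geomPoints W, P ∈ geomTorsion W (p : ℤ) ∧ f P ≠ 0)
    (f' : Isogeny W' W) (hf' : ∃ P : geomPoints W', P ∈ geomTorsion W' (p : ℤ) ∧ f' P ≠ 0) :
    GVPar W p ↔ GVPar W' p :=
  ⟨gvPar_of_isogeny hp2 hL hc f hf, gvPar_of_isogeny hp2 hL' hc' f' hf'⟩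

end Main

end Literature.NumberTheory.EllipticCurves.Rank1Residual

end
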